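import Literature.Dynamics.Hyperbolic.SequenceShadowingGreen

/-!
# Shadowing for a sequence of maps of a Banach space, III: Pilyugin's Theorem 1.3.1 (existence)

`IsHyperbolicSequence.exists_shadow`: for a `(λ,N)`-hyperbolic sequence `(A, P, B)` on a Banach space `E`
and maps `φ_k : E → E` whose nonlinear parts `φ_k - A_k` are `κ`-Lipschitz on the ball `‖v‖ ≤ Δ` with
`κ N₁ < 1`: if `‖φ_k(0)‖ ≤ d ≤ d₀ = Δ/L`, `L = N₁/(1-κN₁)`, there is a trajectory `φ_k(v_k) = v_{k+1}`
with `‖v_k‖ ≤ L d` (S. Yu. Pilyugin, LNM 1706 (1999), Lemma 1.3.1 + Theorem 1.3.1, case `k ∈ ℤ`).  Proof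
as printed: Banach's fixed point theorem for `v ↦ 𝒢 w̄(v)` on the closed `Ld`-ball of `ℓ_∞(ℤ; E)`
(realised as `ℤ →ᵇ E`), using the Green operator of `SequenceShadowingGreen`.  Fully proved.
Sequel: `SequenceShadowingUniqueness` (uniqueness in the `Δ`-ball, periodic shadows).

## References

* S. Yu. Pilyugin, *Shadowing in Dynamical Systems*, LNM 1706 (1999), §1.3.1, Lemma 1.3.1, Theorem 1.3.1. [Pilyugin1999]
-/

noncomputable section

open Filter Set Function
open scoped Topology NNReal BoundedContinuousFunction

namespace Literature.Dynamics.Hyperbolic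

variable {E : Type*} [NormedAddCommGroup E] [NormedSpace ℝ E]

namespace IsHyperbolicSequence

variable {A P B : ℤ → E →L[ℝ] E} {lam N : ℝ}

variable [CompleteSpace E]

/-- **Pilyugin's Theorem 1.3.1 (shadowing for a sequence of maps of a Banach space, case `k ∈ ℤ`).**
Let `(A, P, B)` be a `(λ, N)`-hyperbolic sequence on the Banach space `E` and let `φ k : E → E` be maps
whose nonlinear parts `w_k = φ_k - A_k` are `κ`-Lipschitz on the ball `‖v‖ ≤ Δ`, with `κ N₁ < 1`,
`N₁ = N(1+λ)/(1-λ)`.  Put `L = N₁/(1-κN₁)`, `d₀ = Δ/L`.  If `‖φ_k(0)‖ ≤ d ≤ d₀` for all `k`, then there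
is a sequence `v_k` with `φ_k(v_k) = v_{k+1}` and `‖v_k‖ ≤ L d` for all `k ∈ ℤ`.  (Proof as printed:
Banach's fixed point theorem for `v ↦ 𝒢 w̄(v)` on the `Ld`-ball of `ℓ_∞(ℤ; E)`.)
-- TODO(general form): different Banach spaces `H_k`; one-sided sequences `k ≥ 0`.
[cite: Pilyugin1999, Thm 1.3.1] -/
theorem exists_shadow (h : IsHyperbolicSequence A P B lam N) {φ : ℤ → E → E} {κ Δ d : ℝ}
    (hκ : 0 ≤ κ) (hd : 0 ≤ d) (hκN : κ * greenBound lam N < 1)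
    (hLip : ∀ (k : ℤ) (v v' : E), ‖v‖ ≤ Δ → ‖v'‖ ≤ Δ →
      ‖(φ k v - A k v) - (φ k v' - A k v')‖ ≤ κ * ‖v - v'‖)
    (hφ0 : ∀ k, ‖φ k 0‖ ≤ d) (hdΔ : d ≤ Δ / shadowConst lam N κ) :
    ∃ v : ℤ → E, (∀ k, ‖v k‖ ≤ shadowConst lam N κ * d) ∧ ∀ k, φ k (v k) = v (k + 1) := by
  -- constants
  set N₁ := greenBound lam N with hN₁
  set L := shadowConst lam N κ with hL
  have hN₁pos : 0 < N₁ := h.greenBound_pos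
  have h1κ : 0 < 1 - κ * N₁ := sub_pos.2 hκN
  have hLdef : L = N₁ / (1 - κ * N₁) := rfl
  have hLpos : 0 < L := by rw [hLdef]; exact div_pos hN₁pos h1κ
  have hLd : L * d ≤ Δ := by rwa [le_div_iff₀ hLpos, mul_comm] at hdΔ
  have hLd0 : 0 ≤ L * d := mul_nonneg hLpos.le hd
  have hΔ : 0 ≤ Δ := hLd0.trans hLd
  have hL1 : L * (1 - κ * N₁) = N₁ := by
    rw [hLdef]; exact div_mul_cancel₀ _ h1κ.ne'
  have hkey : N₁ * (d + κ * (L * d)) = L * d := by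
    calc N₁ * (d + κ * (L * d)) = N₁ * d + κ * N₁ * (L * d) := by ring
      _ = L * (1 - κ * N₁) * d + κ * N₁ * (L * d) := by rw [hL1]
      _ = L * d := by ring
  -- the nonlinearity read along a bounded sequence: `w̄(v)_k = φ_{k-1}(v_{k-1}) - A_{k-1} v_{k-1}`
  let wbar : (ℤ →ᵇ E) → ℤ → E := fun v k => φ (k - 1) (v (k - 1)) - A (k - 1) (v (k - 1))
  have hw_bound : ∀ v : ℤ →ᵇ E, ‖v‖ ≤ L * d → ∀ k, ‖wbar v k‖ ≤ d + κ * (L * d) := by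
    intro v hv k
    have hvk' : ‖v (k - 1)‖ ≤ L * d := (v.norm_coe_le_norm (k - 1)).trans hv
    have hvk : ‖v (k - 1)‖ ≤ Δ := hvk'.trans hLd
    have h1 := hLip (k - 1) (v (k - 1)) 0 hvk (by simpa using hΔ)
    simp only [map_zero, sub_zero] at h1
    calc ‖wbar v k‖ = ‖(φ (k - 1) (v (k - 1)) - A (k - 1) (v (k - 1)) - φ (k - 1) 0) + φ (k - 1) 0‖ := by
          simp only [wbar, sub_add_cancel]
      _ ≤ ‖φ (k - 1) (v (k - 1)) - A (k - 1) (v (k - 1)) - φ (k - 1) 0‖ + ‖φ (k - 1) 0‖ := norm_add_le _ _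
      _ ≤ κ * ‖v (k - 1)‖ + d := add_le_add h1 (hφ0 _)
      _ ≤ κ * (L * d) + d := by gcongr
      _ = d + κ * (L * d) := by ring
  have hw_lip : ∀ v v' : ℤ →ᵇ E, ‖v‖ ≤ L * d → ‖v'‖ ≤ L * d →
      ∀ k, ‖wbar v k - wbar v' k‖ ≤ κ * ‖v - v'‖ := by
    intro v v' hv hv' k
    have hvk : ‖v (k - 1)‖ ≤ Δ := ((v.norm_coe_le_norm (k - 1)).trans hv).trans hLd
    have hvk' : ‖v' (k - 1)‖ ≤ Δ := ((v'.norm_coe_le_norm (k - 1)).trans hv').trans hLd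
    refine (hLip (k - 1) _ _ hvk hvk').trans ?_
    gcongr
    rw [← BoundedContinuousFunction.sub_apply]
    exact (v - v').norm_coe_le_norm (k - 1)
  -- the operator `T v = 𝒢 w̄(v)` on the ball `D` of radius `L d`
  let D : Set (ℤ →ᵇ E) := Metric.closedBall 0 (L * d)
  have hD_norm : ∀ v : ℤ →ᵇ E, v ∈ D ↔ ‖v‖ ≤ L * d := fun v => by
    simp only [D, Metric.mem_closedBall, dist_zero_right]
  have hT_bound : ∀ v : ℤ →ᵇ E, ‖v‖ ≤ L * d → ∀ n, ‖green A P B (wbar v) n‖ ≤ L * d := by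
    intro v hv n
    have := h.norm_green_le (hw_bound v hv) n
    rwa [hkey] at this
  let T : (ℤ →ᵇ E) → (ℤ →ᵇ E) := fun v =>
    if hv : ‖v‖ ≤ L * d then
      BoundedContinuousFunction.ofNormedAddCommGroupDiscrete (green A P B (wbar v)) (L * d) (hT_bound v hv)
    else 0
  have hT_apply : ∀ v : ℤ →ᵇ E, ‖v‖ ≤ L * d → ∀ n, T v n = green A P B (wbar v) n := by
    intro v hv n
    simp only [T, dif_pos hv, BoundedContinuousFunction.coe_ofNormedAddCommGroupDiscrete]
  have hT_maps : MapsTo T D D := by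
    intro v hv
    rw [hD_norm] at hv ⊢
    rw [BoundedContinuousFunction.norm_le hLd0]
    intro n
    rw [hT_apply v hv n]
    exact hT_bound v hv n
  -- `T` contracts on `D` with constant `κ N₁ < 1`
  have hT_lip : ∀ v ∈ D, ∀ v' ∈ D, dist (T v) (T v') ≤ (κ * N₁) * dist v v' := by
    intro v hv v' hv'
    rw [hD_norm] at hv hv'
    rw [dist_eq_norm, dist_eq_norm, BoundedContinuousFunction.norm_le (by positivity)]
    intro n
    rw [BoundedContinuousFunction.sub_apply, hT_apply v hv n, hT_apply v' hv' n,
      ← h.green_sub (hw_bound v hv) (hw_bound v' hv') n]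
    calc ‖green A P B (fun k => wbar v k - wbar v' k) n‖ ≤ N₁ * (κ * ‖v - v'‖) :=
          h.norm_green_le (hw_lip v v' hv hv') n
      _ = κ * N₁ * ‖v - v'‖ := by ring
  have hDc : IsComplete D := Metric.isClosed_closedBall.isComplete
  have hκN0 : 0 ≤ κ * N₁ := mul_nonneg hκ hN₁pos.le
  have hcontr : ContractingWith (κ * N₁).toNNReal (hT_maps.restrict T D D) := by
    refine ⟨Real.toNNReal_lt_one.2 hκN, LipschitzWith.of_dist_le_mul fun x y => ?_⟩
    rw [Subtype.dist_eq, Subtype.dist_eq, MapsTo.val_restrict_apply, MapsTo.val_restrict_apply,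
      Real.coe_toNNReal _ hκN0]
    exact hT_lip x.1 x.2 y.1 y.2
  have h0D : (0 : ℤ →ᵇ E) ∈ D := by rw [hD_norm, norm_zero]; exact hLd0
  obtain ⟨vstar, hvD, hfix, -⟩ := hcontr.exists_fixedPoint' hDc hT_maps h0D (edist_ne_top _ _)
  -- read off the trajectory
  have hv_norm : ‖vstar‖ ≤ L * d := (hD_norm vstar).1 hvD
  have hfix' : ∀ n, vstar n = green A P B (wbar vstar) n := by
    intro n
    have e : T vstar = vstar := hfix
    calc vstar n = T vstar n := by rw [e]
      _ = green A P B (wbar vstar) n := hT_apply vstar hv_norm n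
  refine ⟨fun k => vstar k, fun k => (vstar.norm_coe_le_norm k).trans hv_norm, fun k => ?_⟩
  have hrec := h.A_green (hw_bound vstar hv_norm) k
  have hw1 : wbar vstar (k + 1) = φ k (vstar k) - A k (vstar k) := by
    simp only [wbar, add_sub_cancel_right]
  rw [← hfix' k, ← hfix' (k + 1), hw1, eq_sub_iff_add_eq] at hrec
  simpa using hrec

end IsHyperbolicSequence

end Literature.Dynamics.Hyperbolic

end
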